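import Mathlib
import HarnessLib
import Summits.KontsevichZagierPeriods.KontsevichZagierPeriods.Theses.LinRedNormalForm
import Summits.KontsevichZagierPeriods.KontsevichZagierPeriods.Theorems.LinRedNormalFormDihedralNormalFormStubDeRhamAux1
import Literature.NumberTheory.Transcendental.KZSubcalculusInvariants

/-!
# `DihedralNormalForm`, line `torus-descent-sum-shadow`, stub `stub_deRham` — the translation move
# split into monomial generators (Aux 2)

Support file for the stub `stub_deRham` (effective convergent de Rham reduction of simplicial
Laurent monomials) of the crux `DihedralNormalForm` (stmt-KontsevichZagierPeriods-3912, route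
`LinRedNormalForm`).  The monomial translation move of `…StubDeRhamAux1`
(`TranslationNL.smono_axis_move`: `[Δᵏ⁺¹, P · ∂_p log P] − [Δᵏ, P(hi) − P(lo)] ∈ KZ.relations` for the
Laurent monomial `P = q·∏ tᵢ^{βᵢ}(1-tᵢ)^{γᵢ}∏_{i<j}(tᵢ-tⱼ)^{αᵢⱼ}` along the axis `p`) has ONE bulk
representation whose integrand is the whole logarithmic derivative
`P · (β_p/t_p − γ_p/(1−t_p) + Σ_{j>p} α_{pj}/(t_p−t_j) − Σ_{i<p} α_{ip}/(t_i−t_p))`.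
Here the bulk is split, by rule (1b) (integrand additivity, with integer multipliers
`KZ.IntegralRep.of_constMul_nat_sub_nsmul_mem_relations`), into the MONOMIAL generators
`[Δᵏ⁺¹, P/u]`, one for every letter `u ∈ {t_p, 1 − t_p, t_p − t_c (c > p), t_c − t_p (c < p)}` through
the axis, with the integer coefficients `β_p, −γ_p, α_{pc}, −α_{cp}`:

  `β_p • [P/t_p] − γ_p • [P/(1−t_p)] + Σ_c (±α) • [P/(t_p − t_c)] − [Δᵏ, P(hi) − P(lo)] ∈ KZ.relations`

(`TranslationNL.smono_axis_move_split`, registered form `stub_deRhamAux2`).  Only the generators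
with a non-zero coefficient have to be supplied (absolute integrability of each of them is the
"termwise legality" of the move); the bulk representation of Aux 1 is assembled from them, so no
integrability hypothesis on the total bulk remains.  This is the T-step of the reduction schedule as
a rewriting rule between monomial representations.

References: M. Kontsevich, D. Zagier, *Periods* (2001), §1.2 rules (1b), (3).
-/

noncomputable section

open MeasureTheory Set

namespace Summit.KontsevichZagierPeriods.DihedralNormalForm.TorusDescent

open Literature.NumberTheory.Transcendental
open Literature.ModelTheory.ExponentialFields (IsSemialgebraic)
open Summit.KontsevichZagierPeriods.DihedralNormalForm.VertexSplitting
open Dilation (smono logDer isSemialgebraicFunOn_smono_comp)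

namespace TranslationNL

variable {k : ℕ}

/-! ### Integer multiples (rule 1b) -/

/-- `[σ, a·f] − a • [σ, f] ∈ KZ.relations` for an integer `a`: iterated integrand additivity
(`KZ.IntegralRep.of_constMul_nat_sub_nsmul_mem_relations`) and, for negative `a`, the fact that two
representations with opposite integrands sum to a relation. [cite: KontsevichZagier2001, §1.2 rule (1)] -/
theorem of_sub_zsmul_of_mem_relations {n : ℕ} (a : ℤ) (T R : KZ.IntegralRep n)
    (hd : T.domain = R.domain)
    (h : EqOn T.integrand (fun x => (a : ℝ) * R.integrand x) T.domain) :
    KZ.of T - a • KZ.of R ∈ KZ.relations := by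
  obtain ⟨m, rfl | rfl⟩ := Int.eq_nat_or_neg a
  · have h1 : KZ.of T - KZ.of (R.constMul (m : ℝ) (isAlgebraic_nat m)) ∈ KZ.relations :=
      KZ.of_sub_of_mem_relations_of_eqOn (by simp [hd]) fun x hx => by
        rw [h hx, KZ.IntegralRep.integrand_constMul, Int.cast_natCast]
    have h2 := KZ.IntegralRep.of_constMul_nat_sub_nsmul_mem_relations R m
    have h3 := KZ.relations.add_mem h1 h2
    rw [natCast_zsmul]
    convert h3 using 1
    abel
  · have h1 : KZ.of (R.constMul (m : ℝ) (isAlgebraic_nat m)) + KZ.of T ∈ KZ.relations :=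
      KZ.of_add_of_mem_relations_of_eqOn_neg (by simp [hd]) fun x hx => by
        have hx' : x ∈ T.domain := by rw [hd]; simpa using hx
        rw [Pi.neg_apply, h hx', KZ.IntegralRep.integrand_constMul, Int.cast_neg, Int.cast_natCast]
        ring
    have h2 := KZ.IntegralRep.of_constMul_nat_sub_nsmul_mem_relations R m
    have h3 := KZ.relations.sub_mem h1 h2
    rw [neg_smul, natCast_zsmul, sub_neg_eq_add]
    convert h3 using 1
    abel

/-! ### The bulk as a combination of the monomial generators -/

/-- Pointwise: `P · ∂_p log P = β_p·(P/t_p) + (−γ_p)·(P/(1−t_p)) + Σ_c (±α)·(P/(t_p − t_c))`.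
[folklore] -/
theorem bulk_eq_sum (p : Fin (k + 1)) (q : ℚ) (β γ : Fin (k + 1) → ℤ)
    (α : Fin (k + 1) → Fin (k + 1) → ℤ) (t : Fin (k + 1) → ℝ) :
    smono q β γ α t * logDer β γ α t (Pi.single p 1) =
      ((β p : ℤ) : ℝ) * (smono q β γ α t / t p) +
        ((-γ p : ℤ) : ℝ) * (smono q β γ α t / (1 - t p)) +
        ∑ c, ((if p < c then α p c else if c < p then -α c p else 0 : ℤ) : ℝ) *
          (smono q β γ α t / (if p < c then t p - t c else t c - t p)) := by
  rw [logDer_single, ← Finset.sum_sub_distrib, mul_add, mul_sub, Finset.mul_sum]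
  have hc : ∀ c : Fin (k + 1), smono q β γ α t *
      ((if p < c then (α p c : ℝ) / (t p - t c) else 0) -
        (if c < p then (α c p : ℝ) / (t c - t p) else 0)) =
      ((if p < c then α p c else if c < p then -α c p else 0 : ℤ) : ℝ) *
        (smono q β γ α t / (if p < c then t p - t c else t c - t p)) := by
    intro c
    by_cases h1 : p < c
    · have h2 : ¬ c < p := not_lt.2 h1.le
      simp only [if_pos h1, if_neg h2]
      ring
    · by_cases h2 : c < p
      · simp only [if_neg h1, if_pos h2]
        push_cast
        ring
      · simp only [if_neg h1, if_neg h2]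
        push_cast
        ring
  simp only [hc]
  push_cast
  ring

/-- A scaled generator `a · g` is integrable on the simplex as soon as `g` is represented whenever
`a ≠ 0`. [folklore] -/
theorem integrableOn_zsmul_piece {a : ℤ} {g : (Fin (k + 1) → ℝ) → ℝ} {R : KZ.IntegralRep (k + 1)}
    (hR : a ≠ 0 → R.domain = KZ.openOrderedSimplex (k + 1) ∧ EqOn R.integrand g R.domain) :
    IntegrableOn (fun t => (a : ℝ) * g t) (KZ.openOrderedSimplex (k + 1)) := by
  by_cases ha : a = 0
  · simp only [ha, Int.cast_zero, zero_mul]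
    exact integrableOn_zero
  · obtain ⟨hd, he⟩ := hR ha
    have hi : IntegrableOn R.integrand (KZ.openOrderedSimplex (k + 1)) := hd ▸ R.integrableOn
    exact (hi.congr_fun (fun x hx => he (by rw [hd]; exact hx))
      (KZ.isOpen_openOrderedSimplex _).measurableSet).const_mul _

/-- A scaled generator is congruent to the integer multiple of its representation. [folklore] -/
theorem piece_sub_zsmul_mem {a : ℤ} {g : (Fin (k + 1) → ℝ) → ℝ} {R T : KZ.IntegralRep (k + 1)}
    (hR : a ≠ 0 → R.domain = KZ.openOrderedSimplex (k + 1) ∧ EqOn R.integrand g R.domain)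
    (hTd : T.domain = KZ.openOrderedSimplex (k + 1))
    (hT : ∀ x, T.integrand x = (a : ℝ) * g x) :
    KZ.of T - a • KZ.of R ∈ KZ.relations := by
  by_cases ha : a = 0
  · subst ha
    rw [zero_smul, sub_zero]
    exact KZ.of_mem_relations_of_eqOn_zero T fun x _ => by simp [hT]
  · obtain ⟨hd, he⟩ := hR ha
    refine of_sub_zsmul_of_mem_relations a T R (by rw [hTd, hd]) fun x hx => ?_
    show T.integrand x = (a : ℝ) * R.integrand x
    rw [hT, he (by rw [hd, ← hTd]; exact hx)]

/-! ### The move, split -/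

/-- **The monomial translation move split into monomial generators.**  With
`P = smono q β γ α` on `Δᵏ⁺¹` and an axis `p`: if for every letter `u` through `p` with non-zero
exponent a representation of `P/u` on `Δᵏ⁺¹` is given (`Rβ` for `t_p`, `Rγ` for `1 − t_p`, `Rα c`
for `t_p − t_c` (`c > p`) resp. `t_c − t_p` (`c < p`)), if `rb = [Δᵏ, P(hi) − P(lo)]`, and if the
letters collapsing at the end points of the fibre carry non-negative exponents, then
`β_p • [Rβ] − γ_p • [Rγ] + Σ_c (α_{pc} resp. −α_{cp}) • [Rα c] − [rb] ∈ KZ.relations`.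
[cite: KontsevichZagier2001, §1.2 rules (1b), (3)] -/
theorem smono_axis_move_split (p : Fin (k + 1)) (q : ℚ) (β γ : Fin (k + 1) → ℤ)
    (α : Fin (k + 1) → Fin (k + 1) → ℤ) (Rβ Rγ : KZ.IntegralRep (k + 1))
    (Rα : Fin (k + 1) → KZ.IntegralRep (k + 1)) (rb : KZ.IntegralRep k)
    (hβ : β p ≠ 0 → Rβ.domain = KZ.openOrderedSimplex (k + 1) ∧
      EqOn Rβ.integrand (fun t => smono q β γ α t / t p) Rβ.domain)
    (hγ : γ p ≠ 0 → Rγ.domain = KZ.openOrderedSimplex (k + 1) ∧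
      EqOn Rγ.integrand (fun t => smono q β γ α t / (1 - t p)) Rγ.domain)
    (hα : ∀ c, (if p < c then α p c else if c < p then -α c p else 0) ≠ 0 →
      (Rα c).domain = KZ.openOrderedSimplex (k + 1) ∧
      EqOn (Rα c).integrand
        (fun t => smono q β γ α t / (if p < c then t p - t c else t c - t p)) (Rα c).domain)
    (hbdom : rb.domain = KZ.openOrderedSimplex k)
    (hbase : EqOn rb.integrand (fun y => smono q β γ α (Fin.insertNth p (hiEdge p y) y) -
      smono q β γ α (Fin.insertNth p (loEdge p y) y)) rb.domain)
    (hhi : if h : 0 < (p : ℕ) then 0 ≤ α ⟨(p : ℕ) - 1, by omega⟩ p else 0 ≤ γ p)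
    (hlo : if h : (p : ℕ) < k then 0 ≤ α p ⟨(p : ℕ) + 1, by omega⟩ else 0 ≤ β p) :
    (β p • KZ.of Rβ - γ p • KZ.of Rγ +
        ∑ c, (if p < c then α p c else if c < p then -α c p else 0) • KZ.of (Rα c)) -
      KZ.of rb ∈ KZ.relations := by
  classical
  set Δ := KZ.openOrderedSimplex (k + 1) with hΔ
  have hS : IsSemialgebraic ℚ Δ := KZ.isSemialgebraic_openOrderedSimplex (k + 1)
  have hsm : IsSemialgebraicFunOn ℚ Δ (smono q β γ α) :=
    isSemialgebraicFunOn_smono_comp hS q β γ α (X := fun t => t)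
      fun i => isSemialgebraicFunOn_apply hS i
  have hap := fun i => isSemialgebraicFunOn_apply hS i
  have h1 : IsSemialgebraicFunOn ℚ Δ fun _ : Fin (k + 1) → ℝ => (1 : ℝ) := by
    simpa using isSemialgebraicFunOn_const_ratCast hS 1
  -- the generators and their coefficients, indexed by `Option (Option (Fin (k+1)))`
  let cf : Option (Option (Fin (k + 1))) → ℤ := fun o => o.elim (β p) fun o' =>
    o'.elim (-γ p) fun c => if p < c then α p c else if c < p then -α c p else 0
  let g : Option (Option (Fin (k + 1))) → (Fin (k + 1) → ℝ) → ℝ := fun o => o.elim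
    (fun t => smono q β γ α t / t p) fun o' => o'.elim (fun t => smono q β γ α t / (1 - t p))
      fun c => fun t => smono q β γ α t / (if p < c then t p - t c else t c - t p)
  let Rr : Option (Option (Fin (k + 1))) → KZ.IntegralRep (k + 1) := fun o => o.elim Rβ fun o' =>
    o'.elim Rγ fun c => Rα c
  have hRr : ∀ o, cf o ≠ 0 → (Rr o).domain = Δ ∧ EqOn (Rr o).integrand (g o) (Rr o).domain := by
    rintro (_ | _ | c) h
    · exact hβ h
    · exact hγ (by simpa [cf] using h)
    · exact hα c h
  have hg : ∀ o, IsSemialgebraicFunOn ℚ Δ (g o) := by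
    rintro (_ | _ | c)
    · simpa [g, div_eq_mul_inv] using hsm.fun_mul (hap p).fun_inv
    · simpa [g, div_eq_mul_inv] using hsm.fun_mul (h1.fun_sub (hap p)).fun_inv
    · by_cases hc : p < c
      · simpa [g, div_eq_mul_inv, hc] using hsm.fun_mul ((hap p).fun_sub (hap c)).fun_inv
      · simpa [g, div_eq_mul_inv, hc] using hsm.fun_mul ((hap c).fun_sub (hap p)).fun_inv
  -- the scaled generators as representations
  let T : Option (Option (Fin (k + 1))) → KZ.IntegralRep (k + 1) := fun o =>
    { domain := Δ
      integrand := fun t => (cf o : ℝ) * g o t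
      isSemialgebraic_domain := hS
      isSemialgebraicFunOn_integrand := (isSemialgebraicFunOn_const_intCast hS (cf o)).fun_mul (hg o)
      integrableOn := integrableOn_zsmul_piece (hRr o) }
  -- the bulk
  have hbulk : ∀ t, smono q β γ α t * logDer β γ α t (Pi.single p 1) = ∑ o, (T o).integrand t := by
    intro t
    rw [bulk_eq_sum, Fintype.sum_option, Fintype.sum_option]
    simp only [T, cf, g, Option.elim]
    ring
  let R : KZ.IntegralRep (k + 1) :=
    { domain := Δ
      integrand := fun t => smono q β γ α t * logDer β γ α t (Pi.single p 1)
      isSemialgebraic_domain := hS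
      isSemialgebraicFunOn_integrand :=
        hsm.fun_mul (isSemialgebraicFunOn_logDer_single hS p β γ α)
      integrableOn := by
        have hi : IntegrableOn (fun t => ∑ o, (T o).integrand t) Δ :=
          integrable_finsetSum _ fun o _ => (T o).integrableOn
        exact hi.congr_fun (fun t _ => (hbulk t).symm) (KZ.isOpen_openOrderedSimplex _).measurableSet }
  -- (3): the move with the assembled bulk
  have hmove : KZ.of R - KZ.of rb ∈ KZ.relations :=
    smono_axis_move p q β γ α R rb rfl (fun _ _ => rfl) hbdom hbase hhi hlo
  -- (1b): split the bulk
  have hsplit : KZ.of R - ∑ o, KZ.of (T o) ∈ KZ.relations :=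
    of_sub_sum_mem_relations Finset.univ T R (fun _ _ => rfl) fun t _ => hbulk t
  -- (1b): integer multiples
  have hpieces : ∑ o, KZ.of (T o) - ∑ o, cf o • KZ.of (Rr o) ∈ KZ.relations := by
    rw [← Finset.sum_sub_distrib]
    exact sum_mem fun o _ => piece_sub_zsmul_mem (hRr o) rfl fun _ => rfl
  have hsum : ∑ o, cf o • KZ.of (Rr o) = β p • KZ.of Rβ - γ p • KZ.of Rγ +
      ∑ c, (if p < c then α p c else if c < p then -α c p else 0) • KZ.of (Rα c) := by
    rw [Fintype.sum_option, Fintype.sum_option]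
    simp only [cf, Rr, Option.elim, neg_smul]
    abel
  have h := KZ.relations.sub_mem (KZ.relations.sub_mem hmove hsplit) hpieces
  rw [hsum] at h
  convert h using 1
  abel

end TranslationNL

open TranslationNL in
/-- **Registered support stub `stub_deRhamAux2`** of `stub_deRham` (line `torus-descent-sum-shadow`):
the MONOMIAL TRANSLATION MOVE SPLIT INTO MONOMIAL GENERATORS (the T-step of the schedule as a
reduction rule).  For the Laurent monomial `P = q·∏ tᵢ^{βᵢ}(1-tᵢ)^{γᵢ}∏_{i<j}(tᵢ-tⱼ)^{αᵢⱼ}` on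
`Δᵏ⁺¹ = {1 > t₀ > ⋯ > t_k > 0}` and an axis `p`: given, for every letter `u` through `p` whose
coefficient is non-zero, a representation on `Δᵏ⁺¹` of the bulk monomial `P/u` — `Rβ` for `u = t_p`
(coefficient `β_p`), `Rγ` for `u = 1 − t_p` (coefficient `−γ_p`), `Rα c` for `u = t_p − t_c`, `c > p`
(coefficient `α_{pc}`) resp. `u = t_c − t_p`, `c < p` (coefficient `−α_{cp}`) —, the face
representation `rb = [Δᵏ, P|_{t_p → t_{p-1}} − P|_{t_p → t_{p+1}}]` (`t_p → 1` when `p = 0`,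
`t_p → 0` when `p = k`), and non-negative exponents on the two letters adjacent to the axis, then
`β_p • [Rβ] − γ_p • [Rγ] + Σ_c (±α) • [Rα c] − [rb] ∈ KZ.relations`
(`= TranslationNL.smono_axis_move_split`: Aux 1 + rule (1b)). [cite: KontsevichZagier2001, §1.2 rule (3)] -/
theorem stub_deRhamAux2 : ∀ (k : ℕ) (p : Fin (k + 1)) (q : ℚ) (β γ : Fin (k + 1) → ℤ) (α : Fin (k + 1) → Fin (k + 1) → ℤ) (Rβ Rγ : Literature.NumberTheory.Transcendental.KZ.IntegralRep (k + 1)) (Rα : Fin (k + 1) → Literature.NumberTheory.Transcendental.KZ.IntegralRep (k + 1)) (rb : Literature.NumberTheory.Transcendental.KZ.IntegralRep k), (β p ≠ 0 → Rβ.domain = {t : Fin (k + 1) → ℝ | (∀ i, 0 < t i) ∧ (∀ i, t i < 1) ∧ StrictAnti t} ∧ Set.EqOn Rβ.integrand (fun t => (q : ℝ) * ((∏ i : Fin (k + 1), t i ^ β i) * (∏ i : Fin (k + 1), (1 - t i) ^ γ i) * ∏ i : Fin (k + 1), ∏ j : Fin (k + 1), if i < j then (t i - t j) ^ α i j else 1)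 / t p) Rβ.domain) → (γ p ≠ 0 → Rγ.domain = {t : Fin (k + 1) → ℝ | (∀ i, 0 < t i) ∧ (∀ i, t i < 1) ∧ StrictAnti t} ∧ Set.EqOn Rγ.integrand (fun t => (q : ℝ) * ((∏ i : Fin (k + 1), t i ^ β i) * (∏ i : Fin (k + 1), (1 - t i) ^ γ i) * ∏ i : Fin (k + 1), ∏ j : Fin (k + 1), if i < j then (t i - t j) ^ α i j else 1) / (1 - t p)) Rγ.domain) → (∀ c : Fin (k + 1), (if p < c then α p c else if c < p then -α c p else 0) ≠ 0 → (Rα c).domain = {t : Fin (k + 1) → ℝ | (∀ i, 0 < t i) ∧ (∀ i, t i < 1) ∧ StrictAnti t} ∧ Set.EqOn (Rα c).integrand (fun t => (q : ℝ) * ((∏ i : Fin (k + 1), t i ^ β i) * (∏ i : Fin (k + 1), (1 - t i) ^ γ i) * ∏ i : Fin (k + 1), ∏ j : Fin (k + 1), if i < j then (t i - t j) ^ α i j else 1) / (if p < c then t p - t c else t c - t p)) (Rα c).domain) → rb.domain = {t : Fin k → ℝ | (∀ i, 0 < t i) ∧ (∀ i, t i < 1) ∧ StrictAnti t} → Set.EqOn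 rb.integrand (fun y => (q : ℝ) * ((∏ i : Fin (k + 1), (Fin.insertNth p (if h : 0 < (p : ℕ) then y ⟨(p : ℕ) - 1, by omega⟩ else 1) y : Fin (k + 1) → ℝ) i ^ β i) * (∏ i : Fin (k + 1), (1 - (Fin.insertNth p (if h : 0 < (p : ℕ) then y ⟨(p : ℕ) - 1, by omega⟩ else 1) y : Fin (k + 1) → ℝ) i) ^ γ i) * ∏ i : Fin (k + 1), ∏ j : Fin (k + 1), if i < j then ((Fin.insertNth p (if h : 0 < (p : ℕ) then y ⟨(p : ℕ) - 1, by omega⟩ else 1) y : Fin (k + 1) → ℝ) i - (Fin.insertNth p (if h : 0 < (p : ℕ) then y ⟨(p : ℕ) - 1, by omega⟩ else 1) y : Fin (k + 1) → ℝ) j) ^ α i j else 1) - (q : ℝ) * ((∏ i : Fin (k + 1), (Fin.insertNth p (if h : (p : ℕ) < k then y ⟨p, h⟩ else 0) y : Fin (k + 1) → ℝ) i ^ β i) * (∏ i : Fin (k + 1), (1 - (Fin.insertNth p (if h : (p : ℕ) < k then y ⟨p, h⟩ else 0) y : Fin (k + 1) → ℝ) i) ^ γ i) * ∏ i : Fin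 (k + 1), ∏ j : Fin (k + 1), if i < j then ((Fin.insertNth p (if h : (p : ℕ) < k then y ⟨p, h⟩ else 0) y : Fin (k + 1) → ℝ) i - (Fin.insertNth p (if h : (p : ℕ) < k then y ⟨p, h⟩ else 0) y : Fin (k + 1) → ℝ) j) ^ α i j else 1)) rb.domain → (if h : 0 < (p : ℕ) then 0 ≤ α ⟨(p : ℕ) - 1, by omega⟩ p else 0 ≤ γ p) → (if h : (p : ℕ) < k then 0 ≤ α p ⟨(p : ℕ) + 1, by omega⟩ else 0 ≤ β p) → (β p • Literature.NumberTheory.Transcendental.KZ.of Rβ - γ p • Literature.NumberTheory.Transcendental.KZ.of Rγ + ∑ c : Fin (k + 1), (if p < c then α p c else if c < p then -α c p else 0) • Literature.NumberTheory.Transcendental.KZ.of (Rα c)) - Literature.NumberTheory.Transcendental.KZ.of rb ∈ Literature.NumberTheory.Transcendental.KZ.relations := by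
  intro k p q β γ α Rβ Rγ Rα rb hβ hγ hα hbdom hbase hhi hlo
  exact smono_axis_move_split p q β γ α Rβ Rγ Rα rb hβ hγ hα hbdom hbase hhi hlo

end Summit.KontsevichZagierPeriods.DihedralNormalForm.TorusDescent

end
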